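import Mathlib.FieldTheory.Finite.Basic
import Mathlib.RingTheory.LocalRing.ResidueField.Basic
import Literature.NumberTheory.GaloisRepresentations.LocalOneUnitsNumberFieldProofs
import Literature.NumberTheory.GaloisRepresentations.HeckeCharacterProofs
import HarnessLib

/-!
# `ℤ_p`-valued characters of `𝒪_vˣ` are trivial for `v ∤ p` (proofs only)

Topic `NumberTheory/GaloisRepresentations` (local fields at the places of a number field);
namespace `Literature.OneUnits`.  No new definitions.

Let `K` be a number field, `p` a prime and `v` a finite place of `K` **not** above `p`, with
residue field of order `q` (a power of the residue characteristic `ℓ ≠ p`).  Then every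
continuous character `ψ : 𝒪_vˣ → ℤ_p` is trivial
(`continuousMonoidHom_eq_one_of_not_mem`): `U_v = μ_{q-1} × U_v^{(1)}` with `U_v^{(1)}` a
pro-`ℓ`-group, and `ℤ_p` has neither torsion nor non-trivial `ℓ`-divisible... more precisely:
for `u ∈ U^{(1)}`, `u^{q^j} → 1` (`valued_pow_pow_sub_one_le`), so `q^j ψ(u) → 0` `p`-adically,
forcing `ψ(u) = 0` as `q` is prime to `p`; and `u^{q-1} ∈ U^{(1)}` for every unit `u`.  This is
the local reason why continuous `ℤ_p`-valued characters of the idele class group are unramified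
outside `p` (Washington, *Introduction to Cyclotomic Fields*, §13.1, proof of Thm. 13.4: only
the places above `p` contribute to `Gal(K̃/K)`; Neukirch, *Algebraic Number Theory*, Ch. II
(5.3)–(5.7): `U^{(1)}` is a `ℤ_ℓ`-module).

## Main results

* `valued_pow_sub_one_le`, `valued_pow_pow_sub_one_le` : `|y^{q^j} - 1| ≤ ρ^j |y - 1|`,
  `ρ = max(|q|, |y - 1|)`, for `|y - 1| < 1` in `K_v`.
* `exists_forall_valued_le_toAdd_mem` : continuity of `ψ : 𝒪_vˣ → ℤ_p` at `1` in terms of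
  valuations.
* `continuousMonoidHom_eq_one_of_not_mem` : `Hom_cont(𝒪_vˣ, ℤ_p) = 0` for `v ∤ p`.

## References

* L. C. Washington, *Introduction to Cyclotomic Fields*, 2nd ed., GTM 83, §13.1, Thm. 13.4.
* J. Neukirch, *Algebraic Number Theory*, Springer 1999, Ch. II (5.3)–(5.7).
-/

noncomputable section

open NumberField IsDedekindDomain Topology

namespace Literature.NumberTheory.GaloisRepresentations

namespace OneUnits

universe u

variable (K : Type u) [Field K] [NumberField K] (v : HeightOneSpectrum (𝓞 K))

/-- In a valued field, if `|y - 1| ≤ 1` then `|y^q - 1| ≤ |y - 1| · max(|q|, |y - 1|)`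
(`y^q - 1 = (y - 1)(1 + y + ⋯ + y^{q-1})` and `1 + y + ⋯ + y^{q-1} ≡ q (mod y - 1)`).
[folklore] -/
theorem valued_pow_sub_one_le (y : v.adicCompletion K) (hy : Valued.v (y - 1) ≤ 1) (q : ℕ) :
    Valued.v (y ^ q - 1) ≤
      Valued.v (y - 1) * max (Valued.v (q : v.adicCompletion K)) (Valued.v (y - 1)) := by
  have hy1 : Valued.v y ≤ 1 := by
    have : y = (y - 1) + 1 := by ring
    rw [this]
    exact (Valuation.map_add _ _ _).trans (max_le hy (by rw [map_one]))
  -- `|∑_{i<k} y^i| ≤ 1`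
  have hgeom1 : ∀ k : ℕ, Valued.v (∑ i ∈ Finset.range k, y ^ i) ≤ 1 := fun k =>
    Valuation.map_sum_le _ fun i _ => by rw [map_pow]; exact pow_le_one₀ zero_le hy1
  -- `|y^i - 1| ≤ |y - 1|`
  have hpow : ∀ i : ℕ, Valued.v (y ^ i - 1) ≤ Valued.v (y - 1) := fun i => by
    rw [← geom_sum_mul, map_mul]
    exact mul_le_of_le_one_left zero_le (hgeom1 i)
  -- `∑_{i<q} y^i = q + ∑_{i<q} (y^i - 1)`
  have hsum : (∑ i ∈ Finset.range q, y ^ i) =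
      (q : v.adicCompletion K) + ∑ i ∈ Finset.range q, (y ^ i - 1) := by
    rw [Finset.sum_sub_distrib, Finset.sum_const, Finset.card_range, nsmul_eq_mul, mul_one]
    ring
  have hS : Valued.v (∑ i ∈ Finset.range q, y ^ i) ≤
      max (Valued.v (q : v.adicCompletion K)) (Valued.v (y - 1)) := by
    rw [hsum]
    refine (Valuation.map_add _ _ _).trans (max_le_max le_rfl ?_)
    exact Valuation.map_sum_le _ fun i _ => hpow i
  rw [← geom_sum_mul, map_mul, mul_comm]
  exact mul_le_mul' le_rfl hS

/-- Iterating: for `|y - 1| ≤ 1`, `|y^{q^j} - 1| ≤ ρ^j |y - 1|` with `ρ = max(|q|, |y - 1|)`.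
[folklore] -/
theorem valued_pow_pow_sub_one_le (y : v.adicCompletion K) (hy : Valued.v (y - 1) ≤ 1) (q j : ℕ) :
    Valued.v (y ^ q ^ j - 1) ≤
      max (Valued.v (q : v.adicCompletion K)) (Valued.v (y - 1)) ^ j * Valued.v (y - 1) := by
  induction j with
  | zero => rw [pow_zero, pow_one, pow_zero, one_mul]
  | succ j ih =>
    have hq1 : Valued.v (q : v.adicCompletion K) ≤ 1 := by
      have : (q : v.adicCompletion K) = ((q : v.adicCompletionIntegers K) : v.adicCompletion K) := rfl
      rw [this]; exact (q : v.adicCompletionIntegers K).2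
    have hρ1 : max (Valued.v (q : v.adicCompletion K)) (Valued.v (y - 1)) ≤ 1 := max_le hq1 hy
    have hj1 : Valued.v (y ^ q ^ j - 1) ≤ Valued.v (y - 1) :=
      ih.trans (mul_le_of_le_one_left zero_le (pow_le_one₀ zero_le hρ1))
    have h1 := valued_pow_sub_one_le K v (y ^ q ^ j) (hj1.trans hy) q
    rw [pow_succ, pow_mul]
    refine h1.trans ?_
    calc Valued.v (y ^ q ^ j - 1) * max (Valued.v (q : v.adicCompletion K)) (Valued.v (y ^ q ^ j - 1))
        ≤ (max (Valued.v (q : v.adicCompletion K)) (Valued.v (y - 1)) ^ j * Valued.v (y - 1)) *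
            max (Valued.v (q : v.adicCompletion K)) (Valued.v (y - 1)) :=
          mul_le_mul' ih (max_le_max le_rfl hj1)
      _ = _ := by rw [mul_right_comm, ← pow_succ]

variable (p : ℕ) [Fact p.Prime]

/-- **Continuity of a `ℤ_p`-valued character of `𝒪_vˣ` at `1`, in valuation terms**: for every
`N` there is `e` such that `ψ(u) ∈ p^N ℤ_p` whenever `|u - 1| ≤ |ϖ_v|^e`.  (Neighbourhoods of
`1` in `𝒪_vˣ` for the units topology contain such congruence subgroups, `|u⁻¹ - 1| = |u - 1|`
for units.) [folklore] -/
theorem exists_forall_valued_le_toAdd_mem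
    (ψ : (v.adicCompletionIntegers K)ˣ →ₜ* Multiplicative ℤ_[p]) (N : ℕ) :
    ∃ e : ℕ, ∀ u : (v.adicCompletionIntegers K)ˣ,
      Valued.v (((u : v.adicCompletionIntegers K) : v.adicCompletion K) - 1) ≤
        WithZero.exp (-(e : ℤ)) → (ψ u).toAdd ∈ Ideal.span {(p : ℤ_[p]) ^ N} := by
  -- the open subgroup `p^N ℤ_p` pulled back to `𝒪_vˣ`
  have hV : IsOpen {z : Multiplicative ℤ_[p] | PadicInt.toZModPow N z.toAdd = 0} :=
    (isOpen_setOf_toZModPow_eq p N 0).preimage continuous_toAdd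
  have h1 : ψ ⁻¹' {z : Multiplicative ℤ_[p] | PadicInt.toZModPow N z.toAdd = 0} ∈
      𝓝 (1 : (v.adicCompletionIntegers K)ˣ) :=
    ψ.continuous.continuousAt.preimage_mem_nhds (hV.mem_nhds (by simp))
  -- unpack the units topology (`Literature.NumberTheory.GaloisRepresentations.Units.exists_nhds_one_val_inv`)
  obtain ⟨U, hU, hUH⟩ := Units.exists_nhds_one_val_inv h1
  obtain ⟨e₁, he₁⟩ := adicCompletionIntegers_exists_ball_subset v hU
  obtain ⟨e₂, he₂⟩ := adicCompletionIntegers_exists_ball_subset v hU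
  refine ⟨max e₁ e₂, fun u hu => ?_⟩
  have hle1 : WithZero.exp (-((max e₁ e₂ : ℕ) : ℤ)) ≤ WithZero.exp (-(e₁ : ℤ)) :=
    WithZero.exp_le_exp.2 (by simp)
  have hle2 : WithZero.exp (-((max e₁ e₂ : ℕ) : ℤ)) ≤ WithZero.exp (-(e₂ : ℤ)) :=
    WithZero.exp_le_exp.2 (by simp)
  -- `|u⁻¹ - 1| = |u - 1|`
  have hunit : Valued.v (((u : v.adicCompletionIntegers K) : v.adicCompletion K)) = 1 :=
    (Valuation.Integers.isUnit_iff_valuation_eq_one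
      (Valuation.valuationSubring.integers _)).1 (Units.isUnit u)
  have hinv : Valued.v ((((u⁻¹ : (v.adicCompletionIntegers K)ˣ) : v.adicCompletionIntegers K) :
      v.adicCompletion K) - 1) =
      Valued.v (((u : v.adicCompletionIntegers K) : v.adicCompletion K) - 1) := by
    have hmul : (((u⁻¹ : (v.adicCompletionIntegers K)ˣ) : v.adicCompletionIntegers K) :
        v.adicCompletion K) * ((u : v.adicCompletionIntegers K) : v.adicCompletion K) = 1 := by
      rw [← Subring.coe_mul, ← Units.val_mul, inv_mul_cancel, Units.val_one]; rfl
    have : (((u⁻¹ : (v.adicCompletionIntegers K)ˣ) : v.adicCompletionIntegers K) :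
        v.adicCompletion K) - 1 =
        (((u⁻¹ : (v.adicCompletionIntegers K)ˣ) : v.adicCompletionIntegers K) :
          v.adicCompletion K) * (1 - ((u : v.adicCompletionIntegers K) : v.adicCompletion K)) := by
      rw [mul_sub, mul_one, hmul]
    rw [this, map_mul, Valuation.map_sub_swap]
    have h2 := congrArg Valued.v hmul
    rw [map_mul, hunit, mul_one, map_one] at h2
    rw [h2, one_mul]
  have hmem : u ∈ ψ ⁻¹' {z : Multiplicative ℤ_[p] | PadicInt.toZModPow N z.toAdd = 0} := by
    refine hUH u (he₁ _ (hu.trans hle1)) (he₂ _ ?_)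
    rw [hinv]
    exact hu.trans hle2
  rw [Set.mem_preimage, Set.mem_setOf_eq] at hmem
  rw [← PadicInt.ker_toZModPow, RingHom.mem_ker]
  exact hmem

/-- **Continuous `ℤ_p`-valued characters of `𝒪_vˣ` are trivial for `v ∤ p`.**  Let `v` be a
finite place of the number field `K` with `p ∉ v` and `ψ : 𝒪_vˣ → ℤ_p` a continuous
homomorphism.  Then `ψ = 0`: with `q = #k_v` (prime to `p`), `u^{q-1} ∈ U^{(1)}` for every unit
`u`, and for `y ∈ U^{(1)}`, `y^{q^j} → 1`, so `q^j ψ(y) ∈ p^N ℤ_p` for `j ≫ 0`, whence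
`ψ(y) ∈ p^N ℤ_p` for all `N`.  Equivalently `Hom_cont(U_v, ℤ_p) = 0`: `ℤ_p`-extensions are
unramified outside `p`.  Ref: Washington, *Introduction to Cyclotomic Fields*, §13.1 (proof of
Thm. 13.4; Prop. 13.2: `ℤ_p`-extensions are unramified outside `p`); Neukirch, *Algebraic
Number Theory*, Ch. II (5.7). [folklore] -/
theorem continuousMonoidHom_eq_one_of_not_mem (hv : (p : 𝓞 K) ∉ v.asIdeal)
    (ψ : (v.adicCompletionIntegers K)ˣ →ₜ* Multiplicative ℤ_[p]) : ψ = 1 := by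
  classical
  have hp : p.Prime := Fact.out
  -- the residue field and its cardinality `q`
  haveI : Finite (IsLocalRing.ResidueField (v.adicCompletionIntegers K)) :=
    Literature.NumberTheory.Automorphic.finite_residueField_adicCompletion K v
  letI : Fintype (IsLocalRing.ResidueField (v.adicCompletionIntegers K)) := Fintype.ofFinite _
  set q : ℕ := Fintype.card (IsLocalRing.ResidueField (v.adicCompletionIntegers K)) with hq_def
  have hq1 : 1 < q := Fintype.one_lt_card
  -- valuation of elements of the maximal ideal
  have hmax : ∀ z : v.adicCompletionIntegers K,
      z ∈ IsLocalRing.maximalIdeal (v.adicCompletionIntegers K) ↔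
        Valued.v (z : v.adicCompletion K) < 1 := fun z => by
    rw [IsLocalRing.mem_maximalIdeal, mem_nonunits_iff]
    exact Valuation.Integer.not_isUnit_iff_valuation_lt_one
  -- `|q| < 1`
  have hqv : Valued.v ((q : v.adicCompletionIntegers K) : v.adicCompletion K) < 1 := by
    rw [← hmax, ← IsLocalRing.residue_eq_zero_iff, map_natCast, hq_def]
    exact FiniteField.cast_card_eq_zero _
  -- `p` is prime to `q`
  have hcop : Nat.Coprime p q := by
    obtain ⟨ℓ, hchar, n', hℓ, hcard⟩ := FiniteField.card' (IsLocalRing.ResidueField (v.adicCompletionIntegers K))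
    rw [hq_def, hcard]
    refine Nat.Coprime.pow_right _ ((Nat.coprime_primes hp hℓ).2 fun hpl => hv ?_)
    -- if `p = ℓ` then `p ∈ 𝔪_v`, i.e. `p ∈ v`
    have h1 : (IsLocalRing.residue (v.adicCompletionIntegers K)) (p : v.adicCompletionIntegers K) = 0 := by
      rw [map_natCast, hpl]; exact CharP.cast_eq_zero _ ℓ
    rw [IsLocalRing.residue_eq_zero_iff, hmax, valued_natCast_adicCompletionIntegers] at h1
    exact (v.intValuation_lt_one_iff_mem _).1 h1
  -- it suffices to treat `ψ u` for each `u`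
  suffices h : ∀ u, (ψ u).toAdd = 0 by
    ext u
    exact Multiplicative.toAdd.injective ((h u).trans toAdd_one.symm)
  intro u
  -- `y = u^{q-1}` is a one-unit
  set w : (v.adicCompletionIntegers K)ˣ := u ^ (q - 1) with hw_def
  have hw1 : Valued.v (((w : v.adicCompletionIntegers K) : v.adicCompletion K) - 1) < 1 := by
    have hres : IsLocalRing.residue (v.adicCompletionIntegers K) ((w : v.adicCompletionIntegers K) - 1) = 0 := by
      rw [map_sub, hw_def, Units.val_pow_eq_pow_val, map_pow, hq_def,
        FiniteField.pow_card_sub_one_eq_one _ ((IsLocalRing.residue_ne_zero_iff_isUnit _).2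
          (Units.isUnit u)), map_one, sub_self]
    rw [IsLocalRing.residue_eq_zero_iff, hmax] at hres
    exact hres
  -- `ψ w` is divisible by every power of `p`
  have hdiv : ∀ N : ℕ, PadicInt.toZModPow N (ψ w).toAdd = 0 := by
    intro N
    obtain ⟨e, he⟩ := exists_forall_valued_le_toAdd_mem K v p ψ N
    -- choose `j` with `ρ^j |w - 1| ≤ |ϖ|^e`
    set y : v.adicCompletion K := ((w : v.adicCompletionIntegers K) : v.adicCompletion K) with hy_def
    set ρ := max (Valued.v (q : v.adicCompletion K)) (Valued.v (y - 1)) with hρ_def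
    have hρ1 : ρ < 1 := max_lt hqv hw1
    have hρe : ρ ≤ WithZero.exp (-1 : ℤ) := by
      by_cases hρ0 : ρ = 0
      · rw [hρ0]; exact zero_le
      · rw [← WithZero.exp_log hρ0, WithZero.exp_le_exp]
        have : WithZero.log ρ < 0 := by
          rw [← WithZero.exp_lt_exp, WithZero.exp_log hρ0, WithZero.exp_zero]; exact hρ1
        omega
    have hj : Valued.v (y ^ q ^ e - 1) ≤ WithZero.exp (-(e : ℤ)) := by
      refine (valued_pow_pow_sub_one_le K v y hw1.le q e).trans ?_
      calc ρ ^ e * Valued.v (y - 1) ≤ WithZero.exp (-1 : ℤ) ^ e * 1 :=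
            mul_le_mul' (pow_le_pow_left₀ zero_le hρe e) hw1.le
        _ = WithZero.exp (-(e : ℤ)) := by
            rw [mul_one, ← WithZero.exp_nsmul]; simp
    have hmem := he (w ^ q ^ e) (by
      rw [Units.val_pow_eq_pow_val, Subring.coe_pow]; exact hj)
    rw [← PadicInt.ker_toZModPow, RingHom.mem_ker, map_pow, toAdd_pow, map_nsmul,
      nsmul_eq_mul] at hmem
    -- `q^e` is a unit modulo `p^N`
    have hu' : IsUnit ((q ^ e : ℕ) : ZMod (p ^ N)) := by
      rw [← ZMod.coe_unitOfCoprime (q ^ e) ((hcop.symm.pow_left e).pow_right N)]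
      exact Units.isUnit _
    rw [Nat.cast_pow] at hu'
    exact (hu'.mul_right_eq_zero).1 (by exact_mod_cast hmem)
  have hw0 : (ψ w).toAdd = 0 := PadicInt.ext_of_toZModPow.1 fun N => by rw [hdiv, map_zero]
  -- `(q - 1) ψ u = ψ w = 0`
  rw [hw_def, map_pow, toAdd_pow, nsmul_eq_mul, mul_eq_zero] at hw0
  refine hw0.resolve_left ?_
  have : (q - 1 : ℕ) ≠ 0 := by omega
  exact_mod_cast this

end OneUnits

end Literature.NumberTheory.GaloisRepresentations
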